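import Summits.CriticalPhenomena.SAWScalingLimit.Theorems.SAWRenewalTightnessSubseqIdentificationThm65TiltedAvoidance
import Summits.CriticalPhenomena.SAWScalingLimit.Theorems.SAWRenewalTightnessSubseqIdentificationThm65TiltedUntilt
import Summits.CriticalPhenomena.SAWScalingLimit.Theorems.SAWRenewalTightnessSubseqIdentificationThm65TiltedImageBM
import HarnessLib

/-!
# The tilted [LSW] Theorem 6.5 (line `boundary-area-law`, RS5b): the assembly from the tilted martingale identities

Line `boundary-area-law` of the crux `SubseqIdentification` (stmt-CriticalPhenomena-0783), restriction
reshape (lead c4, r-c4-3), stub RS5b `stub_thm65Tilted` (G. F. Lawler, O. Schramm, W. Werner,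
*Conformal restriction: the chordal case*, J. Amer. Math. Soc. 16 (2003), Prop. 5.3 with §5
(5.1)–(5.3), read through Girsanov: under `Q̄_A = (Y_∞/Φ_A′(0)^α)·P` the curve `Φ_A(γ)` is SLE_κ).

`stub_thm65Tilted_of_tiltedMartingales` — **RS5b REDUCED TO THE TWO TILTED `P`-MARTINGALE
IDENTITIES (T2)**: if for every `0 < κ ≤ 8/3` and nonempty `A ∈ 𝒬*` some compensated restriction
martingale `Y` of Prop. 5.3 (spec `IsRestrictionMartingaleK κ α_κ λ_κ A (LpK κ A) Y`) makes
`Mⁿ·Y` and `((Mⁿ)² − κ cⁿ)·Y` martingales of the Brownian filtration for all localisation levels `n`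
(`Mⁿ = imgMartK κ hA hne n` the localised image driving function `h_t(W_t)`, `cⁿ = imgClockK κ hA hne n`
its capacity clock), then the registered statement of `stub_thm65Tilted` holds for all
`κ, A, B, Φ, d`. Chain of landed milestones: (T3) `hasMartingaleClock_imgMartK_tilted` (change of
measure by Bayes' formula) → (T4) `exists_sle_image_brownian_tilted` (DDS + concatenation under
`Q̄_A`) → (T5)+(T6) `tilted_avoid_hullProduct_of_imageBM` (`Q̄_A[γ ∩ (B·A) = ∅] = P[γ ∩ B = ∅]`;
`Q̄_A` avoids `A` a.s. by the density identity (T1) `thm65_terminal_density`) → (T7)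
`thm65Tilted_of_tilted` (un-tilting); `A = ∅` is `stub_thm65Tilted_empty`.

References: [LSW] Prop. 5.3, §5 (5.1)–(5.3), Thm. 6.5. No named fact is used.
-/

noncomputable section

open Set Filter Topology Function Complex Metric MeasureTheory ProbabilityTheory
open UpperHalfPlane (upperHalfPlaneSet)
open scoped NNReal unitInterval ENNReal
open Literature.Probability.RandomPlanarGeometry
open Literature.Probability.Process

namespace Summit.CriticalPhenomena.SAWScalingLimit.Theorems.SubseqIdentification.BoundaryAreaLaw

open Loewner

/-! ### The assembly: RS5b from the two tilted martingale identities (T2) -/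

section Assembly

/-- **RS5b REDUCED TO (T2).** The registered statement of `stub_thm65Tilted` — the tilted [LSW]
Theorem 6.5, `E[1{γ ∩ A = ∅, Φ_A(γ(0,∞)) ∩ B = ∅} X_A] = Φ_A′(0)^α P[γ ∩ B = ∅]` for all
`0 < κ ≤ 8/3`, `A, B ∈ 𝒬*` — follows from the TWO `P`-MARTINGALE IDENTITIES (T2): for every nonempty
`A ∈ 𝒬*` some compensated restriction martingale `Y` of [LSW] Prop. 5.3 (spec
`IsRestrictionMartingaleK κ α_κ λ_κ A (LpK κ A) Y`; e.g. `YbarK`, `isRestrictionMartingaleK_YbarK`) makes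
`Mⁿ · Y` and `((Mⁿ)² − κ cⁿ) · Y` martingales of the Brownian filtration for every localisation level
`n` (`Mⁿ = imgMartK κ hA hne n`, `cⁿ = imgClockK κ hA hne n`) — in print `d(W̃Y) = W̃ dY + Y dW̃ + d⟨W̃, Y⟩`
with `dW̃ = h′ dW + (κ/2 − 3) h″ dt` ([LSW] (5.1)–(5.3)), `dY = Y α √κ (h″/h′) dB` (Prop. 5.3), so the
drift is `Y h″ (κ/2 − 3 + ακ) dt = 0`. Chain: (T3) `hasMartingaleClock_imgMartK_tilted` → (T4)
`exists_sle_image_brownian_tilted` → (T5)+(T6) `tilted_avoid_hullProduct_of_imageBM` (under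
`Q̄_A = (Y_∞/Φ_A′(0)^α)·P`, which avoids `A` a.s. by the density identity (T1)) → (T7)
`thm65Tilted_of_tilted`; `A = ∅` is `stub_thm65Tilted_empty`.
[cite: LawlerSchrammWerner2003Restriction, Prop. 5.3 with §5 (5.1)–(5.3) and Thm. 6.5] -/
theorem stub_thm65Tilted_of_tiltedMartingales :
    (∀ (κ : ℝ≥0), 0 < κ → κ ≤ 8 / 3 → ∀ (A : Set ℂ) (hA : IsStarHull A) (hne : A.Nonempty),
      ∃ Y : ℝ≥0 → (ℝ≥0 → ℝ) → ℝ,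
        IsRestrictionMartingaleK κ (sleBubbleExponent κ) (sleBubbleIntensityReal κ) A (LpK κ A) Y ∧
        ∀ n : ℕ, Martingale (fun t ω => imgMartK κ hA hne n t ω * Y t ω) brownianFiltration preWienerMeasure ∧
          Martingale (fun t ω => (imgMartK κ hA hne n t ω ^ 2 - κ * imgClockK κ hA hne n t ω) * Y t ω)
            brownianFiltration preWienerMeasure) →
    ∀ (κ : ℝ≥0), 0 < κ → κ ≤ 8 / 3 → ∀ (A B : Set ℂ), IsStarHull A → IsStarHull B →
      ∀ (Φ : ConformalEquiv (upperHalfPlaneSet \ A) upperHalfPlaneSet), IsRestrictionMap A Φ →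
        ∀ (d : ℝ), HasRestrictionDeriv A Φ d →
          ∫⁻ ω, {ω | Disjoint (range (sleTrace κ ω)) A ∧ ∀ t, 0 < t → Φ (sleTrace κ ω t) ∉ B}.indicator
              (fun ω => poissonAvoidance (sleBubbleIntensity κ *
                ∫⁻ t, ENNReal.ofReal (starBubbleMass (Loewner.slidHull (sleDriving κ ω) A t)) ∂timeMeasure)) ω
            ∂preWienerMeasure =
          ENNReal.ofReal (d ^ sleBubbleExponent κ) * preWienerMeasure {ω | Disjoint (range (sleTrace κ ω)) B} := by
  intro hT2 κ hκ0 hκ A B hA hB Φ hΦ d hd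
  rcases A.eq_empty_or_nonempty with rfl | hne
  · exact stub_thm65Tilted_empty κ hκ0 hκ B hB Φ hΦ d hd
  haveI := isProbabilityMeasure_preWienerMeasure'
  set P : Measure (ℝ≥0 → ℝ) := preWienerMeasure with hPdef
  have hκ4 : κ ≤ 4 := le_four_of_le_eightThirds hκ
  have hκ8 : κ ≠ 8 := ne_eight_of_le_eightThirds hκ
  obtain ⟨Y, hY, hmart⟩ := hT2 κ hκ0 hκ A hA hne
  set α : ℝ := sleBubbleExponent κ with hαdef
  have hdpos : 0 < d := HasRestrictionDeriv.pos IsStarHull.exists_hasRestrictionDeriv_holds hA hΦ hd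
  set m : ℝ := d ^ α with hm
  have hm0 : 0 < m := Real.rpow_pos_of_pos hdpos _
  -- the normalised tilted probability
  set Q : Measure (ℝ≥0 → ℝ) := P.withDensity fun ω ↦ ENNReal.ofReal (m⁻¹ * Yinf Y ω) with hQdef
  obtain ⟨hprob, -⟩ := hasMartingaleClock_imgMartK_tilted κ hκ0 hκ A hA hne Φ hΦ d hd Y hY 0 (hmart 0).1 (hmart 0).2
  haveI : IsProbabilityMeasure Q := hprob
  have hQP : Q ≪ P := withDensity_absolutelyContinuous _ _
  have hBM := fun n : ℕ ↦ exists_sle_image_brownian_tilted κ hκ0 hκ A hA hne Φ hΦ d hd Y hY n (hmart n).1 (hmart n).2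
  -- under `Q` the trace avoids `A`
  set EA : Set (ℝ≥0 → ℝ) := {ω | Disjoint (range (sleTrace κ ω)) A} with hEA
  have hnullA : NullMeasurableSet EA P := nullMeasurableSet_setOf_disjoint hκ8 hA.isBoundedHull.isClosed
  have hdens := thm65_terminal_density hκ0 hκ hA hne hΦ hd hY
  have hQA : ∀ᵐ ω ∂Q, Disjoint (range (sleTrace κ ω)) A := by
    rw [Filter.Eventually, mem_ae_iff]
    show Q EAᶜ = 0
    rw [hQdef, withDensity_apply' _ EAᶜ]
    have hzero : ∀ᵐ ω ∂P.restrict EAᶜ, ENNReal.ofReal (m⁻¹ * Yinf Y ω) = 0 := by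
      rw [ae_restrict_iff'₀ hnullA.compl]
      filter_upwards [hdens] with ω hω hωc
      have h1 : ENNReal.ofReal (Yinf Y ω) = 0 := by
        rw [hω, indicator_of_notMem hωc]
      rw [ENNReal.ofReal_mul (inv_pos.2 hm0).le, h1, mul_zero]
    rw [lintegral_congr_ae hzero, lintegral_zero]
  -- (T6) under `Q`, then rescale to the un-normalised tilt and un-tilt
  have h6 := tilted_avoid_hullProduct_of_imageBM hκ0 hκ4 hA hne hB hΦ hQP hQA hBM
  have hscale : (P.withDensity fun ω ↦ ENNReal.ofReal (Yinf Y ω)) = ENNReal.ofReal m • Q := by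
    have e : (fun ω ↦ ENNReal.ofReal (Yinf Y ω)) = ENNReal.ofReal m • fun ω ↦ ENNReal.ofReal (m⁻¹ * Yinf Y ω) := by
      funext ω
      simp only [Pi.smul_apply, smul_eq_mul]
      rw [← ENNReal.ofReal_mul hm0.le, ← mul_assoc, mul_inv_cancel₀ hm0.ne', one_mul]
    rw [e, withDensity_smul' _ _ ENNReal.ofReal_ne_top]
  have htilt : (P.withDensity fun ω ↦ ENNReal.ofReal (Yinf Y ω)) {ω | Disjoint (range (sleTrace κ ω)) (hullProduct B A Φ)} =
      ENNReal.ofReal (d ^ sleBubbleExponent κ) * P {ω | Disjoint (range (sleTrace κ ω)) B} := by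
    rw [hscale, Measure.smul_apply, smul_eq_mul, h6]
  exact thm65Tilted_of_tilted κ hκ0 hκ A B hA hne hB Φ hΦ d hd Y hY htilt

end Assembly

end Summit.CriticalPhenomena.SAWScalingLimit.Theorems.SubseqIdentification.BoundaryAreaLaw

end
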